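import Literature.Geometry.Lorentzian.QuasiFinalTemporalChart
import Literature.Geometry.Lorentzian.ADMTailLabelLines
import HarnessLib

/-!
# Far label lines of a quasi-final late chart are future-directed timelike (Ellithy 2026, §4.1 + Def. 4.4)

A. Ellithy, *The spacetime Penrose inequality under a quasi final state hypothesis*,
arXiv:2605.18730 (2026), §4.1 (p. 38: the chart time is a smooth Cauchy temporal function) and
Definition 4.4 (p. 39: ADM form with coefficient tuple in `𝒞𝒮♯_{-τ}`); A. N. Bernal, M. Sánchez,
Lett. Math. Phys. 77 (2006), §2 (p. 3: temporal functions).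

Synthesis of the two typed clauses of the late chart `Φ`:

* `IsQuasiFinalTemporalChart g τ 𝓣 Φ T̲ r₀` (`QuasiFinalTemporalChart`): the chart time `t` is the
  Cauchy temporal function `𝓣` — so `d𝓣(∂_t) = 1` along the chart;
* `HasADMForm I g.val Φ T̲ r₀ 𝒮` with `𝒮 ∈ 𝒞𝒮_{-τ}(ℳ)` (`QuasiFinalAnalytic`, `ADMTailLabelLines`): far
  out, `g(∂_t, ∂_t) = -(N² - |β|²_{g(t)}) ≤ -c₀ < 0` — the label lines are timelike.

A timelike vector `v` with `d𝓣(v) > 0` for a temporal function `𝓣` is FUTURE-directed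
(`LorentzianMetric.IsTemporalFunction.isFutureDirected_of_mfderiv_pos`: a causal vector is future- or
past-directed, and `d𝓣 > 0` on future-directed ones, Bernal–Sánchez loc. cit.).  Hence
(`IsQuasiFinalTemporalChart.label_futureDirected`): there are `R > r₀`, `c₀ > 0` such that for all
`t > T̲`, `|y| ≥ R` the label velocity `∂_t Φ := d(Φ ∘ polar)_{(t,y)}(1, 0)` is timelike,
future-directed, with `g(∂_t Φ, ∂_t Φ) ≤ -c₀` — the late label lines far out are future-directed
timelike curves parametrised by Cauchy time.  (Side facts: the chart is differentiable wherever its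
pulled-back form is nonzero, `mdifferentiableAt_polarChart_of_pullback_ne_zero`; `d𝓣(∂_t Φ) = 1`,
`IsChartTime.mfderiv_label_eq_one`.)  Curve form (§ `LabelLine`): for `r > 0` the label line
`γ(u) = Φ(u, r, p)` is `(Φ ∘ polar) ∘ (u ↦ (u, r p))`, its velocity is `d(Φ ∘ polar)_{(u, r p)}(1, 0)`
(`velocity_labelLine_eq`), and far label lines are future-directed timelike curves on `(T̲, ∞)` in the
sense of `LorentzianMetric.IsFutureTimelikeCurveOn`, with `g(γ̇, γ̇) ≤ -c₀`
(`IsQuasiFinalTemporalChart.labelLine_isFutureTimelikeCurveOn`).  No facts; nothing here is specific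
to any summit.

## References

* [Ellithy2026] A. Ellithy, arXiv:2605.18730 (2026), §4.1 (p. 38), Def. 4.4 (p. 39).
* [BernalSanchez2006] A. N. Bernal, M. Sánchez, Lett. Math. Phys. 77 (2006), §2 (p. 3).
-/

noncomputable section

open Set Metric Function Filter
open scoped Manifold ContDiff Topology

namespace Literature.Geometry.Lorentzian

namespace LorentzianMetric

variable {E : Type*} [NormedAddCommGroup E] [NormedSpace ℝ E] {H : Type*} [TopologicalSpace H]
  {I : ModelWithCorners ℝ E H} {n : ℕ∞ω} {M : Type*} [TopologicalSpace M] [ChartedSpace H M]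
  [IsManifold I ∞ M] {g : LorentzianMetric I n M} {τ : TimeOrientation g} {𝓣 : M → ℝ}

/-- **A causal vector on which a temporal function increases is future-directed** (Bernal–Sánchez
2006, §2, p. 3: temporal = past-directed timelike gradient, i.e. `d𝓣 > 0` exactly on the future
causal cone): if `v` is causal and `d𝓣(v) > 0` then `v` is future-directed (a causal vector is future-
or past-directed, and on a past-directed `v`, `d𝓣(v) = -d𝓣(-v) < 0`).
[cite: BernalSanchez2006, §2 p. 3] -/
theorem IsTemporalFunction.isFutureDirected_of_mfderiv_pos (h : g.IsTemporalFunction τ 𝓣) {x : M}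
    {v : TangentSpace I x} (hv : g.IsCausal v) (hpos : (0 : ℝ) < mfderiv I 𝓘(ℝ, ℝ) 𝓣 x v) :
    τ.IsFutureDirected v := by
  rcases τ.isFutureDirected_or_isPastDirected_of_isCausal hv with hf | hp
  · exact hf
  · exfalso
    have hneg : τ.IsFutureDirected (-v) := (τ.isFutureDirected_neg_iff v).mpr hp
    -- move to genuinely `ℝ`-typed atoms (the values live in `TangentSpace 𝓘(ℝ, ℝ) _ = ℝ`)
    obtain ⟨a, ha⟩ : ∃ a : ℝ, mfderiv I 𝓘(ℝ, ℝ) 𝓣 x v = a := ⟨_, rfl⟩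
    obtain ⟨b, hb⟩ : ∃ b : ℝ, mfderiv I 𝓘(ℝ, ℝ) 𝓣 x (-v) = b := ⟨_, rfl⟩
    have h1 : (0 : ℝ) < b := hb ▸ h.mfderiv_pos hneg
    have h3 : (0 : ℝ) < a := ha ▸ hpos
    have h2 : a + b = 0 := by
      have hadd := map_add (mfderiv I 𝓘(ℝ, ℝ) 𝓣 x) v (-v)
      rw [add_neg_cancel, map_zero, ha, hb] at hadd
      exact hadd.symm
    exact (add_pos h3 h1).ne' h2

end LorentzianMetric

section Chart

variable {EM : Type*} [NormedAddCommGroup EM] [NormedSpace ℝ EM] {HM : Type*}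
  [TopologicalSpace HM] {I : ModelWithCorners ℝ EM HM} {M : Type*} [TopologicalSpace M]
  [ChartedSpace HM M]

/-- **Where the ADM form is nonzero on `∂_t`, the chart is differentiable** (Mathlib's junk
derivative `0` would make the pullback vanish). [cite: Ellithy2026, Def. 4.4 p. 39] -/
theorem mdifferentiableAt_polarChart_of_pullback_ne_zero
    {g : Π x : M, TangentSpace I x →L[ℝ] TangentSpace I x →L[ℝ] ℝ}
    {Φ : ℝ × ℝ × sphere (0 : E3) 1 → M} {q : ℝ × E3} {v w : ℝ × E3}
    (h : pullbackBilin (I := I) (I' := 𝓘(ℝ, ℝ × E3)) (polarChart Φ) g q v w ≠ 0) :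
    MDifferentiableAt 𝓘(ℝ, ℝ × E3) I (polarChart Φ) q := by
  by_contra hnd
  apply h
  rw [pullbackBilin_apply, mfderiv_zero_of_not_mdifferentiableAt hnd]
  simp

/-- **`d𝓣(∂_t Φ) = 1`**: if the chart time is `𝓣` (`IsChartTime`) then, at a late exterior point where
the chart is differentiable and `𝓣` is differentiable, the label velocity `∂_t Φ = d(Φ∘polar)(1, 0)`
satisfies `d𝓣(∂_t Φ) = 1` (chain rule; `𝓣 ∘ Φ ∘ polar = pr₁` near the point).
[cite: Ellithy2026, §4.1 p. 38] -/
theorem IsChartTime.mfderiv_label_eq_one {𝓣 : M → ℝ} {Φ : ℝ × ℝ × sphere (0 : E3) 1 → M}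
    {Tlo r₀ : ℝ} (h : IsChartTime 𝓣 Φ Tlo r₀) {t : ℝ} {y : E3} (ht : Tlo < t) (hy : r₀ < ‖y‖)
    (h𝓣 : MDifferentiableAt I 𝓘(ℝ, ℝ) 𝓣 (polarChart Φ (t, y)))
    (hΦ : MDifferentiableAt 𝓘(ℝ, ℝ × E3) I (polarChart Φ) (t, y)) :
    (mfderiv I 𝓘(ℝ, ℝ) 𝓣 (polarChart Φ (t, y))
      (mfderiv 𝓘(ℝ, ℝ × E3) I (polarChart Φ) (t, y) ((1 : ℝ), (0 : E3))) : ℝ) = (1 : ℝ) := by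
  -- `𝓣 ∘ Φ̃ = pr₁` near `(t, y)`
  have hopen : IsOpen {q : ℝ × E3 | Tlo < q.1 ∧ r₀ < ‖q.2‖} :=
    (isOpen_lt continuous_const continuous_fst).inter (isOpen_lt continuous_const continuous_snd.norm)
  have hev : (𝓣 ∘ polarChart Φ) =ᶠ[𝓝 (t, y)] Prod.fst :=
    Filter.eventuallyEq_of_mem (hopen.mem_nhds ⟨ht, hy⟩) fun q hq ↦ h q.1 q.2 hq.1 hq.2.le
  have hcomp : mfderiv 𝓘(ℝ, ℝ × E3) 𝓘(ℝ, ℝ) (𝓣 ∘ polarChart Φ) (t, y) =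
      (mfderiv I 𝓘(ℝ, ℝ) 𝓣 (polarChart Φ (t, y))).comp
        (mfderiv 𝓘(ℝ, ℝ × E3) I (polarChart Φ) (t, y)) := mfderiv_comp (t, y) h𝓣 hΦ
  have hfst : mfderiv 𝓘(ℝ, ℝ × E3) 𝓘(ℝ, ℝ) (𝓣 ∘ polarChart Φ) (t, y) =
      ContinuousLinearMap.fst ℝ ℝ E3 := by
    rw [hev.mfderiv_eq, mfderiv_eq_fderiv, fderiv_fst]
  have key := ContinuousLinearMap.ext_iff.mp (hcomp.symm.trans hfst) ((1 : ℝ), (0 : E3))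
  exact key

variable {n : ℕ∞ω} [IsManifold I ∞ M] {g : LorentzianMetric I n M} {τ : TimeOrientation g}
  {𝓣 : M → ℝ} {Φ : ℝ × ℝ × sphere (0 : E3) 1 → M} {Tlo r₀ αH τd : ℝ} {S : ADMTailTuple}

/-- **The far label lines of a quasi-final late chart are future-directed timelike** (Ellithy 2026,
§4.1 p. 38 with Def. 4.4 (1) p. 39 and Def. 3.6 p. 21): if the chart time of `Φ` is a Cauchy temporal
function `𝓣` (`IsQuasiFinalTemporalChart`), `Φ^* g` is the ADM form of a tuple `𝒮 ∈ 𝒞𝒮_{-τ}(ℳ_{T̲,r₀})`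
(`r₀ ≥ 0`, `τ > 0`) and the metric is `Cⁿ`, `n ≥ 1`, then there are `R > r₀` and `c₀ > 0` such that for
all `t > T̲`, `|y| ≥ R` the label velocity `∂_t Φ = d(Φ∘polar)_{(t,y)}(1, 0)` is timelike,
future-directed, and `g(∂_t Φ, ∂_t Φ) ≤ -c₀`. [cite: Ellithy2026, §4.1 p. 38; Def. 4.4 p. 39] -/
theorem IsQuasiFinalTemporalChart.label_futureDirected (hT : IsQuasiFinalTemporalChart g τ 𝓣 Φ Tlo r₀)
    (hn : 1 ≤ n) (hA : HasADMForm I g.val Φ Tlo r₀ S) (hS : S.IsTailCoeff αH τd Tlo r₀)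
    (hr₀ : 0 ≤ r₀) (hτd : 0 < τd) :
    ∃ R c₀ : ℝ, r₀ < R ∧ 0 < c₀ ∧ ∀ (t : ℝ) (y : E3), Tlo < t → R ≤ ‖y‖ →
      g.IsTimelike (mfderiv 𝓘(ℝ, ℝ × E3) I (polarChart Φ) (t, y) ((1 : ℝ), (0 : E3))) ∧
      τ.IsFutureDirected (mfderiv 𝓘(ℝ, ℝ × E3) I (polarChart Φ) (t, y) ((1 : ℝ), (0 : E3))) ∧
      g.val (polarChart Φ (t, y)) (mfderiv 𝓘(ℝ, ℝ × E3) I (polarChart Φ) (t, y) ((1 : ℝ), (0 : E3)))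
        (mfderiv 𝓘(ℝ, ℝ × E3) I (polarChart Φ) (t, y) ((1 : ℝ), (0 : E3))) ≤ -c₀ := by
  obtain ⟨R, c₀, hR, hc₀, hfar⟩ := hA.label_timelike hS hr₀ hτd
  refine ⟨R, c₀, hR, hc₀, fun t y ht hy ↦ ?_⟩
  have hle := hfar t y ht hy
  rw [pullbackBilin_apply] at hle
  have htl : g.IsTimelike (mfderiv 𝓘(ℝ, ℝ × E3) I (polarChart Φ) (t, y) ((1 : ℝ), (0 : E3))) :=
    lt_of_le_of_lt hle (by linarith)
  refine ⟨htl, ?_, hle⟩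
  -- the chart is differentiable here (else the pullback would vanish), `𝓣` is differentiable, and
  -- `d𝓣(∂_t Φ) = 1 > 0`
  have hΦ : MDifferentiableAt 𝓘(ℝ, ℝ × E3) I (polarChart Φ) (t, y) := by
    refine mdifferentiableAt_polarChart_of_pullback_ne_zero (g := g.val) (v := ((1 : ℝ), (0 : E3)))
      (w := ((1 : ℝ), (0 : E3))) ?_
    rw [pullbackBilin_apply]
    exact ne_of_lt (lt_of_le_of_lt hle (by linarith))
  have h𝓣 : MDifferentiableAt I 𝓘(ℝ, ℝ) 𝓣 (polarChart Φ (t, y)) :=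
    (hT.1.1.contMDiff.of_le hn).mdifferentiableAt one_ne_zero
  have hone := hT.2.mfderiv_label_eq_one ht (hR.trans_le hy) h𝓣 hΦ
  have hpos : (0 : ℝ) < (mfderiv I 𝓘(ℝ, ℝ) 𝓣 (polarChart Φ (t, y))
      (mfderiv 𝓘(ℝ, ℝ × E3) I (polarChart Φ) (t, y) ((1 : ℝ), (0 : E3))) : ℝ) := by
    rw [hone]; exact one_pos
  exact hT.1.1.isFutureDirected_of_mfderiv_pos htl.isCausal hpos

end Chart

/-! ### Label lines as curves: velocity = chart pullback of `∂_t`; far label lines are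
future-directed timelike curves parametrised by Cauchy time -/

section LabelLine

variable {EM : Type*} [NormedAddCommGroup EM] [NormedSpace ℝ EM] {HM : Type*}
  [TopologicalSpace HM] {I : ModelWithCorners ℝ EM HM} {M : Type*} [TopologicalSpace M]
  [ChartedSpace HM M]

/-- `ray (r p) = p` for `r > 0`, `p ∈ S²`. [folklore] -/
private theorem raySphere_smul_coe {r : ℝ} (hr : 0 < r) (p : sphere (0 : E3) 1) :
    raySphere (r • (p : E3)) = p := by
  have hp : ‖(p : E3)‖ = 1 := by simp
  have hnorm : ‖r • (p : E3)‖ = r := by rw [norm_smul, Real.norm_eq_abs, abs_of_pos hr, hp, mul_one]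
  have hne : r • (p : E3) ≠ 0 := by
    intro h
    rw [h, norm_zero] at hnorm
    exact hr.ne' hnorm.symm
  ext1
  unfold raySphere
  rw [dif_neg hne]
  show ‖r • (p : E3)‖⁻¹ • (r • (p : E3)) = (p : E3)
  rw [hnorm, smul_smul, inv_mul_cancel₀ hr.ne', one_smul]

omit [TopologicalSpace M] in
/-- **A label line is the polar composite of a straight coordinate line**: for `r > 0` and `p ∈ S²`,
`u ↦ Φ(u, r, p)` is `(Φ ∘ polar) ∘ (u ↦ (u, r p))` (the identification `y = r p` of §3.1, p. 20).
[cite: Ellithy2026, §3.1 p. 20] -/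
theorem labelLine_eq_polarChart_comp (Φ : ℝ × ℝ × sphere (0 : E3) 1 → M) {r : ℝ} (hr : 0 < r)
    (p : sphere (0 : E3) 1) :
    (fun u : ℝ ↦ Φ (u, r, p)) = polarChart Φ ∘ fun u : ℝ ↦ ((u, r • (p : E3)) : ℝ × E3) := by
  funext u
  simp only [Function.comp_apply, polarChart]
  rw [raySphere_smul_coe hr p, norm_smul, Real.norm_eq_abs, abs_of_pos hr,
    (by simp : ‖(p : E3)‖ = 1), mul_one]

omit [TopologicalSpace M] in
/-- Pointwise form: `(Φ ∘ polar)(u, r p) = Φ(u, r, p)` for `r > 0`. [cite: Ellithy2026, §3.1 p. 20] -/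
theorem polarChart_apply_smul (Φ : ℝ × ℝ × sphere (0 : E3) 1 → M) {r : ℝ} (hr : 0 < r)
    (p : sphere (0 : E3) 1) (u : ℝ) : polarChart Φ (u, r • (p : E3)) = Φ (u, r, p) := by
  have := congrFun (labelLine_eq_polarChart_comp Φ hr p) u
  simpa only [Function.comp_apply] using this.symm

/-- **Velocity of a label line = chart pullback of `∂_t`**: for `r > 0`, wherever the polar composite
`Φ ∘ polar` is differentiable at `(u, r p)`, the label line `u ↦ Φ(u, r, p)` is differentiable at `u`
and its velocity there is `d(Φ ∘ polar)_{(u, r p)}(1, 0)` (chain rule along `u ↦ (u, r p)`; a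
cross-fibre equation, both sides in the model space). [cite: Ellithy2026, §3.1 p. 20; Def. 4.4 p. 39] -/
theorem velocity_labelLine_eq (Φ : ℝ × ℝ × sphere (0 : E3) 1 → M) {r : ℝ} (hr : 0 < r)
    (p : sphere (0 : E3) 1) (u : ℝ)
    (hΦ : MDifferentiableAt 𝓘(ℝ, ℝ × E3) I (polarChart Φ) (u, r • (p : E3))) :
    MDifferentiableAt 𝓘(ℝ, ℝ) I (fun u : ℝ ↦ Φ (u, r, p)) u ∧
      velocity I (fun u : ℝ ↦ Φ (u, r, p)) u =
        mfderiv 𝓘(ℝ, ℝ × E3) I (polarChart Φ) (u, r • (p : E3)) ((1 : ℝ), (0 : E3)) := by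
  have hline : HasFDerivAt (fun u : ℝ ↦ ((u, r • (p : E3)) : ℝ × E3))
      ((ContinuousLinearMap.id ℝ ℝ).prod (0 : ℝ →L[ℝ] E3)) u :=
    (hasFDerivAt_id u).prodMk (hasFDerivAt_const (r • (p : E3)) u)
  have hcomp : HasMFDerivAt 𝓘(ℝ, ℝ) I (polarChart Φ ∘ fun u : ℝ ↦ ((u, r • (p : E3)) : ℝ × E3)) u
      ((mfderiv 𝓘(ℝ, ℝ × E3) I (polarChart Φ) (u, r • (p : E3))).comp
        ((ContinuousLinearMap.id ℝ ℝ).prod (0 : ℝ →L[ℝ] E3))) :=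
    HasMFDerivAt.comp u (f := fun u : ℝ ↦ ((u, r • (p : E3)) : ℝ × E3)) hΦ.hasMFDerivAt
      hline.hasMFDerivAt
  rw [labelLine_eq_polarChart_comp Φ hr p]
  refine ⟨hcomp.mdifferentiableAt, ?_⟩
  unfold velocity
  rw [hcomp.mfderiv]
  rfl

variable {n : ℕ∞ω} [IsManifold I ∞ M] {g : LorentzianMetric I n M} {τ : TimeOrientation g}
  {𝓣 : M → ℝ} {Φ : ℝ × ℝ × sphere (0 : E3) 1 → M} {Tlo r₀ αH τd : ℝ} {S : ADMTailTuple}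

/-- Transport of `g_x(v, w)` along an equality of base points (the fibres are the model space).
[folklore] -/
private theorem val_congr_point (g : LorentzianMetric I n M) {x x' : M} (h : x = x') (v w : EM) :
    g.val x v w = g.val x' v w := by
  subst h
  rfl

/-- Transport of `IsTimelike` along an equality of base points. [folklore] -/
private theorem isTimelike_congr_point (g : LorentzianMetric I n M) {x x' : M} (h : x = x')
    (v : EM) : g.IsTimelike (x := x) v ↔ g.IsTimelike (x := x') v := by
  subst h
  exact Iff.rfl

/-- Transport of `IsFutureDirected` along an equality of base points. [folklore] -/
private theorem isFutureDirected_congr_point (τ : TimeOrientation g) {x x' : M} (h : x = x')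
    (v : EM) : τ.IsFutureDirected (x := x) v ↔ τ.IsFutureDirected (x := x') v := by
  subst h
  exact Iff.rfl

/-- **Far label lines are future-directed timelike curves parametrised by Cauchy time, uniformly**
(curve form of `label_futureDirected`; Ellithy 2026, §4.1 p. 38 with Def. 4.4 (1) p. 39 and Def. 3.6
p. 21): if the chart time of `Φ` is a Cauchy temporal function `𝓣`, `Φ^* g` is the ADM form of a tuple
`𝒮 ∈ 𝒞𝒮_{-τ}(ℳ_{T̲,r₀})` (`r₀ ≥ 0`, `τ > 0`) and the metric is `Cⁿ`, `n ≥ 1`, then there are `R > r₀`,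
`c₀ > 0` such that for every `r ≥ R` and `p ∈ S²` the label line `γ(u) = Φ(u, r, p)` is a
future-directed timelike curve on `(T̲, ∞)` (`IsFutureTimelikeCurveOn`: differentiable, `γ̇` timelike
and future-directed) with `g(γ̇(u), γ̇(u)) ≤ -c₀` for all `u > T̲`; along it `𝓣(γ(u)) = u`
(`IsChartTime`). [cite: Ellithy2026, §4.1 p. 38; Def. 4.4 p. 39] -/
theorem IsQuasiFinalTemporalChart.labelLine_isFutureTimelikeCurveOn
    (hT : IsQuasiFinalTemporalChart g τ 𝓣 Φ Tlo r₀) (hn : 1 ≤ n) (hA : HasADMForm I g.val Φ Tlo r₀ S)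
    (hS : S.IsTailCoeff αH τd Tlo r₀) (hr₀ : 0 ≤ r₀) (hτd : 0 < τd) :
    ∃ R c₀ : ℝ, r₀ < R ∧ 0 < c₀ ∧ ∀ (r : ℝ) (p : sphere (0 : E3) 1), R ≤ r →
      g.IsFutureTimelikeCurveOn τ (fun u : ℝ ↦ Φ (u, r, p)) (Ioi Tlo) ∧
      ∀ u : ℝ, Tlo < u →
        g.val (Φ (u, r, p)) (velocity I (fun u : ℝ ↦ Φ (u, r, p)) u)
          (velocity I (fun u : ℝ ↦ Φ (u, r, p)) u) ≤ -c₀ := by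
  obtain ⟨R, c₀, hR, hc₀, hfar⟩ := hT.label_futureDirected hn hA hS hr₀ hτd
  refine ⟨R, c₀, hR, hc₀, fun r p hr ↦ ?_⟩
  have hr0 : 0 < r := (hr₀.trans_lt hR).trans_le hr
  have hnorm : ‖r • (p : E3)‖ = r := by
    rw [norm_smul, Real.norm_eq_abs, abs_of_pos hr0, (by simp : ‖(p : E3)‖ = 1), mul_one]
  -- pointwise package along the label line
  have key : ∀ u : ℝ, Tlo < u →
      MDifferentiableAt 𝓘(ℝ, ℝ) I (fun u : ℝ ↦ Φ (u, r, p)) u ∧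
      g.IsTimelike (velocity I (fun u : ℝ ↦ Φ (u, r, p)) u) ∧
      τ.IsFutureDirected (velocity I (fun u : ℝ ↦ Φ (u, r, p)) u) ∧
      g.val (Φ (u, r, p)) (velocity I (fun u : ℝ ↦ Φ (u, r, p)) u)
        (velocity I (fun u : ℝ ↦ Φ (u, r, p)) u) ≤ -c₀ := by
    intro u hu
    obtain ⟨htl, hfut, hle⟩ := hfar u (r • (p : E3)) hu (by rw [hnorm]; exact hr)
    have hΦ : MDifferentiableAt 𝓘(ℝ, ℝ × E3) I (polarChart Φ) (u, r • (p : E3)) := by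
      refine mdifferentiableAt_polarChart_of_pullback_ne_zero (g := g.val) (v := ((1 : ℝ), (0 : E3)))
        (w := ((1 : ℝ), (0 : E3))) ?_
      rw [pullbackBilin_apply]
      exact ne_of_lt (lt_of_le_of_lt hle (by linarith))
    obtain ⟨hdiff, hvel⟩ := velocity_labelLine_eq Φ hr0 p u hΦ
    have hq : polarChart Φ (u, r • (p : E3)) = Φ (u, r, p) := polarChart_apply_smul Φ hr0 p u
    -- move the three facts from the vector `d(Φ∘polar)(1,0)` at `(Φ∘polar)(u, r p)` to the velocity
    -- at `Φ(u, r, p)` (same vector, same point)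
    have htl' : g.IsTimelike (x := polarChart Φ (u, r • (p : E3)))
        (velocity I (fun u : ℝ ↦ Φ (u, r, p)) u) := by rw [hvel]; exact htl
    have hfut' : τ.IsFutureDirected (x := polarChart Φ (u, r • (p : E3)))
        (velocity I (fun u : ℝ ↦ Φ (u, r, p)) u) := by rw [hvel]; exact hfut
    have hle' : g.val (polarChart Φ (u, r • (p : E3))) (velocity I (fun u : ℝ ↦ Φ (u, r, p)) u)
        (velocity I (fun u : ℝ ↦ Φ (u, r, p)) u) ≤ -c₀ := by rw [hvel]; exact hle
    exact ⟨hdiff, (isTimelike_congr_point g hq _).mp htl', (isFutureDirected_congr_point τ hq _).mp hfut',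
      (val_congr_point g hq.symm _ _).trans_le hle'⟩
  exact ⟨fun u hu ↦ ⟨(key u hu).1, (key u hu).2.1, (key u hu).2.2.1⟩, fun u hu ↦ (key u hu).2.2.2⟩

/-- **One late timelike label line, in the letter used by proper-time arguments**: under the
hypotheses of `labelLine_isFutureTimelikeCurveOn` there are a radius `r ≥ r₀`, a late time `u₀ > T̲`
and `c > 0` such that for EVERY direction `p ∈ S²` the label line `u ↦ Φ(u, r, p)` is a future-directed
timelike curve on `[u₀, ∞)` with `g(γ̇(u), γ̇(u)) ≤ -c²` for all `u ≥ u₀` (take `r := R`,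
`u₀ := T̲ + 1`, `c := √c₀`). [cite: Ellithy2026, §4.1 p. 38; Def. 4.4 p. 39] -/
theorem IsQuasiFinalTemporalChart.exists_lateTimelikeLabelLine
    (hT : IsQuasiFinalTemporalChart g τ 𝓣 Φ Tlo r₀) (hn : 1 ≤ n) (hA : HasADMForm I g.val Φ Tlo r₀ S)
    (hS : S.IsTailCoeff αH τd Tlo r₀) (hr₀ : 0 ≤ r₀) (hτd : 0 < τd) :
    ∃ r u₀ c : ℝ, r₀ ≤ r ∧ Tlo < u₀ ∧ 0 < c ∧ ∀ p : sphere (0 : E3) 1,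
      g.IsFutureTimelikeCurveOn τ (fun u : ℝ ↦ Φ (u, r, p)) (Ici u₀) ∧
      ∀ u : ℝ, u₀ ≤ u →
        g.val (Φ (u, r, p)) (velocity I (fun u : ℝ ↦ Φ (u, r, p)) u)
          (velocity I (fun u : ℝ ↦ Φ (u, r, p)) u) ≤ -c ^ 2 := by
  obtain ⟨R, c₀, hR, hc₀, h⟩ := hT.labelLine_isFutureTimelikeCurveOn hn hA hS hr₀ hτd
  have hIci : Ici (Tlo + 1) ⊆ Ioi Tlo := fun u hu ↦ lt_of_lt_of_le (lt_add_one Tlo) hu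
  refine ⟨R, Tlo + 1, Real.sqrt c₀, hR.le, lt_add_one Tlo, Real.sqrt_pos.mpr hc₀, fun p ↦ ?_⟩
  obtain ⟨hcurve, hle⟩ := h R p le_rfl
  refine ⟨hcurve.mono hIci, fun u hu ↦ ?_⟩
  rw [Real.sq_sqrt hc₀.le]
  exact hle u (hIci hu)

end LabelLine

end Literature.Geometry.Lorentzian

end
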